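import Summits.KontsevichZagierPeriods.KontsevichZagierPeriods.Theses.ToricCore
import Summits.KontsevichZagierPeriods.KontsevichZagierPeriods.Theorems.FurushoPentagonSectorToKernelOfLeaves
import Literature.NumberTheory.Transcendental.KZToricCalculus

/-!
# `ToricCofinality` (stmt-KontsevichZagierPeriods-7837, route ToricCore, crux rank 5) — birth skeleton

Crux (the route's REMAINDER off the conical sector):
`ToricCofinality := let T := <toric span>; ∀ c, KZ.eval c = 0 → ∃ t ∈ T, c − t ∈ KZ.relations` —
every vanishing formal combination of integral representations is congruent, modulo the moves of the
Kontsevich–Zagier calculus, to an element of the TORIC SPAN `T` (signed-binomial cells carrying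
Laurent–binomial integrands; the definition item has landed as
`Literature.NumberTheory.Transcendental.KZ.toricSpan`, whose body is the `let T := …` prelude token
for token, so the crux is `∀ c, eval c = 0 → ∃ t ∈ KZ.toricSpan, c − t ∈ relations` by `Iff.rfl`,
`toricCofinality_iff` below). It is summit-implied (`t := 0`, kernel form of Conjecture 1) and, with
the route's target `ToricKernel`, gives the summit (`ToricCore.closes`).

Line (a TOWER through Ayoub's tame-cube sector, read RELATIVE to the toric span): the landed volume /
kernel normal forms of the tree (`KZ.semiCanonicalReduction_holds`, `kzKernelConjecture_iff_isRational`)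
cannot be stubs, so the two registered stubs are the two non-landed floors of the tower

  all representations ──S1──▶ `ℤ[tame cube classes]` ──(merge, landed)──▶ one tame cube ──LEAF──▶ `T + relations`.

* `stub_cubeResolution` (S1, RESOLUTION / COMPILATION; theorem-grade,
  transcendence-free, XL — Hironaka / rectilinearisation strength): every integral representation is,
  modulo the KZ relations, a `ℤ`-combination of TAME CUBE classes `[[0,1]ⁿ, f]`, `f` real-analytic
  near the closed cube (`ReducedPeriodRing.cubicalSpan`,
  `Theorems/FurushoPentagonReducedPeriodRingDefs.lean`). Its spelled-out signature is SHARED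
  byte-for-byte with stub S1 of the registered skeletons of cruxes `FurushoPentagon.SectorToKernel`
  (stmt-10813, line `effective-cube-surjection`), `FurushoPentagon.ReducedPeriodRing` (stmt-3929,
  S1b) and `CommonUnfolding.UnfoldingComplement` (stmt-14445), so ONE proof closes it everywhere; it
  follows from the existing item stmt-KontsevichZagierPeriods-3574 `LiftingCriteria.CubeNashNormalForm`
  (`SectorToKernel.cubeResolution_of_cubeNashNormalForm`, landed) and its bounded-volume residue is
  `SectorToKernel.cubeResolution_of_boundedVolumes` (Viu-Sos 2021, landed).
  [Ayoub 2014, Rem. 12; Huber–Müller-Stach 2017, §12.2; Viu-Sos 2021, Thm. 1.1]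
* `stub_tameCubeToricCofinality` (THE LEAF; conjecture-grade = the
  content of the crux, NEW): **Ayoub's kernel statement modulo the conical sector** — a tame cube
  class `[[0,1]ⁿ, f]` whose integral VANISHES is congruent modulo the KZ relations to an element of
  the toric span. It is the crux restricted to single tame cube classes; it is implied by (and
  strictly weaker than) the leaf S6 of line `effective-cube-surjection` (Ayoub, Ann. of Math. 181
  (2015), Conj. 1.1 at `k = ℚ`) together with S1, which give `[[0,1]ⁿ, f] ∈ relations` outright
  (`t := 0`, `SectorToKernel.kzKernel_of_cubeResolution_of_ayoubKernel`): here the conical /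
  multiple-zeta part of a vanishing tame integrand need not be DERIVED by Stokes elements on the cube,
  it may be LEFT as a toric remainder `t` (whose vanishing value is then the business of the route's
  target `ToricKernel`). This is exactly the route's SECTOR split (`X = ToricKernel ∧ ToricCofinality`)
  transplanted to Ayoub's normal form. [Ayoub 2015, Conj. 1.1; Ayoub 2014, Def. 9–10, Rem. 12–13;
  Kontsevich–Zagier 2001, §1.2; Guo–Paycha–Zhang 2014 (conical sector)]

Composition `ToricCofinality_of : S1-sig → LEAF-sig → ToricCofinality` (sorry-free, concludes the
crux BY NAME): for `c` with `eval c = 0`, S1 and the landed bookkeeping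
`SectorToKernel.leaves_cubeNormalForm` give `a ∈ cubicalSpan` with `c − a ∈ relations`; the landed
merging stub `ReducedPeriodRing.stub_cubeMerge` gives ONE tame cube class `[r]` with
`a − [r] ∈ relations`; soundness of the moves (`KZ.relations_le_ker_eval_holds`) gives
`r.value = eval c = 0`; the leaf gives `t ∈ toricSpan` with `[r] − t ∈ relations`; hence
`c − t = (c − a) + (a − [r]) + ([r] − t) ∈ relations`, and `toricCofinality_iff` rewrites the
inline `let T := …` of the crux as `KZ.toricSpan`. Both stubs are load-bearing: S1 alone says
nothing about vanishing combinations, the leaf alone only treats tame cube classes (neither is the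
crux or the summit by `exact? / simpa / aesop`; BC3 probes recorded in the registrar's NOTES.md).
`ToricCofinality_of_registered_stubs : ToricCofinality` feeds the two sorried stubs in by name; it is
the theorem `ledger skeleton check` records as THE skeleton (a theorem concluding the crux with no
hypothesis beyond the registered stubs), `ToricCofinality_of` being its sorry-free composition.

Disproof used: none on file — `Cruxes/ToricCofinality/` had no workfiles before this one (no
`Disproof.lean`, no ideas, no dead lines; `ledger crux ls stmt-KontsevichZagierPeriods-7837`);
`ledger negatives --problem KontsevichZagierPeriods` has one unrelated entry (KinematicFormulas, plane
convexity). All statements are over existing declarations only (`KZ.toricSpan`, `KZ.cube`,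
`ReducedPeriodRing.cubicalSpan`, `KZ.relations`, `KZ.of`, `KZ.eval`, `IntegralRep.value`).
-/

noncomputable section

set_option linter.dupNamespace false

namespace Summit.KontsevichZagierPeriods.KontsevichZagierPeriods.Cruxes.ToricCofinality.Birth

open Set MeasureTheory
open Literature.NumberTheory.Transcendental
open Literature.NumberTheory.Transcendental.KZ hiding cubicalSpan
open Summit.KontsevichZagierPeriods.KontsevichZagierPeriods.Theses.ToricCore (ToricCofinality)
open Summit.KontsevichZagierPeriods.FurushoPentagon.ReducedPeriodRing (unitCube cubicalGens cubicalSpan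
  stub_cubeMerge)
open Summit.KontsevichZagierPeriods.FurushoPentagon.SectorToKernel (leaves_cubeNormalForm)

/-! ## The crux over the landed definition `KZ.toricSpan` -/

/-- **Unfolding the crux.** The inline `let T := AddSubgroup.closure {…}` of `ToricCofinality` is,
token for token, the body of the landed definition `KZ.toricSpan` (definition item
`defn-ToricRelations`, `Literature/NumberTheory/Transcendental/KZToricCalculus.lean`), so the crux
reads `∀ c, eval c = 0 → ∃ t ∈ toricSpan, c − t ∈ relations` definitionally.
[Kontsevich–Zagier 2001, §1.2; Guo–Paycha–Zhang 2014, §2] -/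
theorem toricCofinality_iff :
    ToricCofinality ↔
      ∀ c : FormalRep, eval c = 0 → ∃ t ∈ toricSpan, c - t ∈ relations :=
  Iff.rfl

/-! ## The two registered stubs -/

/-- **S1 (resolution / compilation; shared byte-for-byte with crux 10813 S1, crux 3929 S1b, crux
14445 S1).** Every integral representation is, modulo the KZ relations, a `ℤ`-combination of tame
cube classes (closed unit cube, integrand real-analytic near it). Theorem-grade (XL): cubical
resolution of the boundary singularities and of the unbounded ends of a `ℚ`-semialgebraic absolutely
convergent integrand, inside rules (1)–(3). [Ayoub 2014, Rem. 12; Viu-Sos 2021, Thm. 1.1;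
Huber–Müller-Stach 2017, §12.2] -/
theorem stub_cubeResolution :
    ∀ (N : ℕ) (u : IntegralRep N), ∃ c : FormalRep, c ∈ cubicalSpan ∧ of u - c ∈ relations := by
  sorry

/-- **LEAF — toric cofinality of vanishing tame cubes (Ayoub's kernel statement modulo the conical
sector).** A tame cube class `[[0,1]ⁿ, f]` (`f` real-analytic near the closed cube) whose integral
vanishes is congruent, modulo the KZ relations, to an element of the toric span `KZ.toricSpan`.
OPEN (period-conjecture strength off the conical sector; this is where the crux's conjecture-grade
content lives): implied by Ayoub's effective cube conjecture (which gives `[[0,1]ⁿ, f] ∈ relations`,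
`t := 0`) and by the summit, strictly weaker than both as stated.
[Ayoub, Ann. of Math. 181 (2015), Conj. 1.1; Ayoub 2014, Def. 9–10, Rem. 13;
Kontsevich–Zagier 2001, §1.2] -/
theorem stub_tameCubeToricCofinality :
    ∀ (n : ℕ) (s : IntegralRep n), s.domain = KZ.cube n → AnalyticOnNhd ℝ s.integrand (KZ.cube n) →
      s.value = 0 → ∃ t ∈ toricSpan, of s - t ∈ relations := by
  sorry

/-! ## Glue (sorry-free) -/

/-- **One vanishing tame cube from a vanishing combination, given S1**: for `c` with `eval c = 0`,
cube resolution (S1, hypothesis) and the landed merging (`stub_cubeMerge`) produce a single tame cube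
class `[r]` with `c − [r] ∈ relations`, and soundness of the moves forces `r.value = 0`.
[Kontsevich–Zagier 2001, §1.2; Ayoub 2014, Rem. 12–13] -/
theorem exists_tameCube_of_eval_eq_zero
    (h1 : ∀ (N : ℕ) (u : IntegralRep N), ∃ c : FormalRep, c ∈ cubicalSpan ∧ of u - c ∈ relations)
    (c : FormalRep) (hc : eval c = 0) :
    ∃ (n : ℕ) (r : IntegralRep n), r.domain = KZ.cube n ∧ AnalyticOnNhd ℝ r.integrand (KZ.cube n) ∧
      r.value = 0 ∧ c - of r ∈ relations := by
  -- (1) cube normal form: `c ∼ a ∈ ℤ[tame cube classes]`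
  obtain ⟨a, ha, hca⟩ := leaves_cubeNormalForm h1 c
  -- (2) merging: `a ∼ [r]`, one tame cube class
  obtain ⟨n, r, hrd, hra, har⟩ := stub_cubeMerge a ha
  have hcr : c - of r ∈ relations := by
    have e : c - of r = (c - a) + (a - of r) := by abel
    rw [e]
    exact relations.add_mem hca har
  -- (3) soundness: `r.value = eval c = 0`
  have hr0 : r.value = 0 := by
    have h := (AddMonoidHom.mem_ker).mp (relations_le_ker_eval_holds hcr)
    rwa [map_sub, hc, zero_sub, neg_eq_zero, eval_of] at h
  exact ⟨n, r, hrd, hra, hr0, hcr⟩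

/-! ## The crux -/

/-- **Composition theorem** (sorry-free; concludes the crux BY NAME from the two stub signatures,
written out as hypotheses):
given `c` with `KZ.eval c = 0`, S1 + merging + soundness give one tame cube class `[r]` of value `0`
with `c − [r] ∈ relations` (`exists_tameCube_of_eval_eq_zero`), the leaf gives a toric `t` with
`[r] − t ∈ relations`, so `c − t = (c − [r]) + ([r] − t) ∈ relations`; `toricCofinality_iff`
identifies the crux's inline toric span with `KZ.toricSpan`.
[Kontsevich–Zagier 2001, §1.2 Conj. 1; Ayoub 2015, Conj. 1.1; Guo–Paycha–Zhang 2014] -/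
theorem ToricCofinality_of :
    (∀ (N : ℕ) (u : IntegralRep N), ∃ c : FormalRep, c ∈ cubicalSpan ∧ of u - c ∈ relations) →
    (∀ (n : ℕ) (s : IntegralRep n), s.domain = KZ.cube n → AnalyticOnNhd ℝ s.integrand (KZ.cube n) →
      s.value = 0 → ∃ t ∈ toricSpan, of s - t ∈ relations) →
    ToricCofinality := by
  intro h1 h2
  rw [toricCofinality_iff]
  intro c hc
  obtain ⟨n, r, hrd, hra, hr0, hcr⟩ := exists_tameCube_of_eval_eq_zero h1 c hc
  obtain ⟨t, ht, hrt⟩ := h2 n r hrd hra hr0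
  refine ⟨t, ht, ?_⟩
  have e : c - t = (c - of r) + (of r - t) := by abel
  rw [e]
  exact relations.add_mem hcr hrt

/-- **Skeleton theorem (registered form).** The crux `ToricCofinality` BY NAME from the two
registered stubs fed into the sorry-free composition `ToricCofinality_of`; its only `sorryAx`
dependencies are `stub_cubeResolution` and `stub_tameCubeToricCofinality`. (This is the theorem
the skeleton audit takes: it concludes the crux and has no hypothesis.) -/
theorem ToricCofinality_of_registered_stubs : ToricCofinality :=
  ToricCofinality_of stub_cubeResolution stub_tameCubeToricCofinality

end Summit.KontsevichZagierPeriods.KontsevichZagierPeriods.Cruxes.ToricCofinality.Birth
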